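import Summits.CriticalPhenomena.PercolationContinuityZ3.Theorems.Transplant.SkelPhiPsiSteps
import Summits.CriticalPhenomena.PercolationContinuityZ3.Theorems.Transplant.SkelPhiStepINegOrient
import Summits.CriticalPhenomena.PercolationContinuityZ3.Theorems.Transplant.SkelPhiRootBridgeGeom
import HarnessLib

/-!
# Quasi-step rung (N3-b), LEVEL 0, row β1 of WAVE-Q-MANIFEST v0.1: `Skelφ.PsiSteps G φ M` (weak unit steps of length `≤ M`, track in the hull widened by one) is
# INVARIANT UNDER THE DERIVED MAPS of the From machinery — transpose `trφ`, orientation `oriφ`, translation `φ − c`, coordinatewise signs `s i · φ`, and the signed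
# root frame `rootFrame φ t σ` — the `PsiSteps` twins of `steps_trφ`, `steps_oriφ`, `steps_sub_const`, `Φ.reflect`'s step field and `steps_rootFrame`

builds on p205010 (kernel theorem, internal audit signed; external expert review pending) — nothing in this file uses p205010; nothing here is a claim about any open node, and the
quasi-step carrier / node of N3B-RUNG.md are NOT declared here (planners' R2).  Lane `prim-bschramm`, seat `prim-bschramm-gen-1` (gen 4; GEN pen).  Helper file
(`--supports stmt-CriticalPhenomena-4575 --as helper`): φ-level, carrier-free, def-free.
WHY (WAVE-Q-MANIFEST §3 row β1, HOME/WAVE-Q-MANIFEST.md; design owner's N3B-RUNG §4 (β)).  In the used cone of the multi-type node p486426 the single-edge step hypothesis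
`Skelφ.Steps G φ` is transported to derived planar maps by `steps_trφ` («SkelPhiOrientation»), `steps_oriφ` («SkelPhiStepINegOrient»), `steps_sub_const`
(«PlanarSkeletonCriticalProbLtOne»), `steps_rootFrame` («SkelPhiRootKitClause») and the reflected carrier («PlanarSkeletonFrmFromReflect»).  Under the quasi-step hypothesis the
currency is `Skelφ.PsiSteps G φ M` («SkelPhiPsiSteps» :39): a vertex ONE unit away in every planar direction, joined by a walk of length `≤ M` whose track stays in the hull of the
two endpoints widened by one.  The hull `Skelφ.InHull a b y` is invariant under every SIGNED PERMUTATION + TRANSLATION of the plane applied to `a, b, y` at once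
(`InHull.rev`, `InHull.sub_const`, `InHull.units_smul`), so `PsiSteps` passes to all five derived maps with the SAME `M` — the regression rule of the manifest (§2) holds by
`psiSteps_of_steps` at `M = 1`.
* §1 hull algebra: `InHull.rev`, `InHull.sub_const`, `InHull.units_smul`;
* §2 **`PsiSteps.trφ`**, **`PsiSteps.oriφ`**, **`PsiSteps.sub_const`**, **`PsiSteps.units_smul`** (coordinatewise signs `s : Fin 2 → ℤˣ` — the chart of `Φ.reflect s`),
  **`PsiSteps.rootFrame`** (`σ = ±1`).
[cite: KozmaNitzan2024, §4 p. 16 (Lemma 8: good coordinates), Lemma 10 Step III (p. 19)] [cite: MartineauTassion2017, §3.2, §4.3]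
-/

noncomputable section

open scoped Classical

namespace Summit.CriticalPhenomena.PercolationContinuityZ3.Theorems.Transplant

namespace Skelφ

open Literature.Probability.Percolation Literature.Probability.LatticeModels SimpleGraph

variable {V : Type} {G : SimpleGraph V} {φ : V → Site 2}

/-! ## §1 The widened hull under signed permutations and translations -/

/-- The widened hull is invariant under exchanging the two coordinates. [folklore] -/
theorem InHull.rev {a b y : Site 2} (h : InHull a b y) : InHull (fun j => a j.rev) (fun j => b j.rev) (fun j => y j.rev) := fun j => h j.rev

/-- The widened hull is invariant under a common translation. [folklore] -/
theorem InHull.sub_const {a b y : Site 2} (c : Site 2) (h : InHull a b y) : InHull (a - c) (b - c) (y - c) := fun j => by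
  obtain ⟨h1, h2⟩ := h j
  simp only [Pi.sub_apply]
  rw [min_sub_sub_right, max_sub_sub_right]
  exact ⟨by omega, by omega⟩

/-- The widened hull is invariant under coordinatewise signs `s i = ±1`. [folklore] -/
theorem InHull.units_smul {a b y : Site 2} (s : Fin 2 → ℤˣ) (h : InHull a b y) :
    InHull (fun j => (s j : ℤ) * a j) (fun j => (s j : ℤ) * b j) (fun j => (s j : ℤ) * y j) := fun j => by
  obtain ⟨h1, h2⟩ := h j
  rcases Int.units_eq_one_or (s j) with hs | hs
  · simp only [hs, Units.val_one, one_mul]; exact ⟨h1, h2⟩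
  · simp only [hs, Units.val_neg, Units.val_one, neg_mul, one_mul, min_neg_neg, max_neg_neg]
    exact ⟨by omega, by omega⟩

/-! ## §2 `PsiSteps` of the derived maps -/

/-- **`PsiSteps` is transposition-invariant** (twin of `steps_trφ`). [cite: KozmaNitzan2024, §4 p. 16 (Lemma 8)] -/
theorem PsiSteps.trφ {M : ℕ} (h : PsiSteps G φ M) : PsiSteps G (Skelφ.trφ φ) M := by
  intro w i σ
  obtain ⟨w', hw', p, hp, htr⟩ := h w i.rev σ
  refine ⟨w', funext fun j => ?_, p, hp, fun u hu => (htr u hu).rev⟩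
  simp only [trφ_apply, hw', Pi.add_apply, Pi.single_apply]
  by_cases hj : j = i
  · subst hj; simp
  · have : j.rev ≠ i.rev := fun e => hj (Fin.rev_injective e)
    simp [hj, this]

/-- **`PsiSteps` of the oriented map** (twin of `steps_oriφ`). [cite: KozmaNitzan2024, §4 p. 16 (Lemma 8)] -/
theorem PsiSteps.oriφ {M : ℕ} (h : PsiSteps G φ M) (b : Bool) : PsiSteps G (Skelφ.oriφ φ b) M := by
  cases b
  · exact h.trφ
  · exact h

/-- **`PsiSteps` is translation-invariant** (twin of `steps_sub_const`). [folklore] -/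
theorem PsiSteps.sub_const {M : ℕ} (h : PsiSteps G φ M) (c : Site 2) : PsiSteps G (fun v => φ v - c) M := by
  intro w i σ
  obtain ⟨w', hw', p, hp, htr⟩ := h w i σ
  refine ⟨w', by show φ w' - c = φ w - c + _; rw [hw']; abel, p, hp, fun u hu => (htr u hu).sub_const c⟩

/-- **`PsiSteps` under coordinatewise signs** `s i = ±1` — the chart `w ↦ (s i · φ w i)ᵢ` of the reflected carrier `Φ.reflect s` (twin of its step field): the direction
`(i, σ)` of the signed map is the direction `(i, s i · σ)` of `φ`. [cite: KozmaNitzan2024, §4 p. 16 (Lemma 8)] -/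
theorem PsiSteps.units_smul {M : ℕ} (h : PsiSteps G φ M) (s : Fin 2 → ℤˣ) : PsiSteps G (fun w j => (s j : ℤ) * φ w j) M := by
  intro w i σ
  obtain ⟨w', hw', p, hp, htr⟩ := h w i (s i * σ)
  refine ⟨w', funext fun j => ?_, p, hp, fun u hu => (htr u hu).units_smul s⟩
  simp only [hw', Pi.add_apply, mul_add]
  by_cases hj : j = i
  · subst hj
    rw [Pi.single_eq_same, Pi.single_eq_same, Units.val_mul, ← mul_assoc, ← Units.val_mul, Int.units_mul_self, Units.val_one, one_mul]
  · rw [Pi.single_eq_of_ne hj, Pi.single_eq_of_ne hj, mul_zero]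

/-- **`PsiSteps` of the signed root frame** `w ↦ (σ·(φ w 0 − φ t 0), φ w 1 − φ t 1)`, `σ = ±1` (twin of `steps_rootFrame`): translate by `φ t`, then sign the along-axis.
[cite: MartineauTassion2017, §3.2] -/
theorem PsiSteps.rootFrame {M : ℕ} (h : PsiSteps G φ M) (t : V) {σ : ℤ} (hσ : σ = 1 ∨ σ = -1) : PsiSteps G (Skelφ.rootFrame φ t σ) M := by
  -- the root frame is the signed translate with signs `(σ, 1)`
  obtain ⟨sσ, hsσ⟩ : ∃ sσ : ℤˣ, (sσ : ℤ) = σ := by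
    rcases hσ with rfl | rfl
    exacts [⟨1, rfl⟩, ⟨-1, rfl⟩]
  have key := (h.sub_const (φ t)).units_smul (fun j => if j = 0 then sσ else 1)
  have e : (fun w j => ((fun j => if j = 0 then sσ else (1 : ℤˣ)) j : ℤ) * (φ w - φ t) j) = Skelφ.rootFrame φ t σ := by
    funext w j
    fin_cases j
    · simp [Skelφ.rootFrame, hsσ]
    · simp [Skelφ.rootFrame]
  rw [e] at key
  exact key

end Skelφ

end Summit.CriticalPhenomena.PercolationContinuityZ3.Theorems.Transplant

end
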